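import Summits.ResolutionOfSingularities.ResolutionOfSingularities.Theorems.FrobeniusLadderFRationalResolutionVeroneseEtaleCharts
import Summits.ResolutionOfSingularities.ResolutionOfSingularities.Theorems.FrobeniusLadderFRationalResolutionVeroneseMemIff
import Summits.ResolutionOfSingularities.ResolutionOfSingularities.Theorems.FrobeniusLadderFRationalResolutionVeroneseDegreeSplit
import Summits.ResolutionOfSingularities.ResolutionOfSingularities.Theorems.FrobeniusLadderFRationalResolutionVeroneseSummand
import Mathlib.RingTheory.MvPolynomial.WeightedHomogeneous
import Mathlib.Algebra.DirectSum.Internal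
import HarnessLib

/-!
# Crux `FrobeniusLadder.FRationalResolution` (stmt-ResolutionOfSingularities-15317), line `redirect`,
# stub `stub_diagonalizableQuotientResolution` — LITERAL instance of the stub's charts: `S = k[x₁,…,xₙ]` graded by `ℤ/r`
# with weights `(1,…,1)`, isolated singularities

The stub's charts are `φ : Spec (.of (𝒮 0)) ⟶ X` for a graded regular `S`; with `S = k[x₁,…,xₙ]`,
`𝒮 = weightedHomogeneousSubmodule k (1,…,1 : Fin n → ℤ/r)` (`MvPolynomial.weightedGradedAlgebra`) the degree-`0` part IS
the Veronese subring (`veronese_eq_gradeZero_subalgebra`: weight of a monomial = its degree mod `r`,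
`veronese_summand_weight_eq_degree`, and a polynomial
lies in the Veronese subring iff `r` divides the degrees of its monomials, `stub_veronese_mem_iff` +
`stub_finsupp_degree_split`), so `…VeroneseEtaleCharts.hasResolution_of_isolated_veronese_etale_charts` becomes:

* **`hasResolution_of_isolated_weightOne_etale_charts`** — an integral `X` locally of finite type over ANY field with
  finitely many singular points, each of the form `φ y` for an ÉTALE `φ : Spec (.of (𝒮 0)) ⟶ X` (`n, r ≥ 2`, `𝒮` as
  above) and the vertex `y` (the point containing every element with vanishing constant term), HAS A RESOLUTION OF
  SINGULARITIES — the endgame stub verbatim on its isolated, weight-`(1,…,1)` charts.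

Honest label: special case of the stub (no stub closed by name). No definitions, no named facts, no sorry.
[folklore; cite: Kollar2007, §2.2]
-/

noncomputable section

-- single-problem summit: the doubled namespace component is forced
set_option linter.dupNamespace false

open CategoryTheory AlgebraicGeometry TopologicalSpace MvPolynomial
open Literature.AlgebraicGeometry.Resolution

namespace Summit.ResolutionOfSingularities.ResolutionOfSingularities.Theorems.FRationalResolution

section Cones

variable (k : Type) [Field k]

/-- The polynomial ring in `n` variables. -/
local notation3 "MP[" n "]" => MvPolynomial (Fin n) k

/-- The `r`-th Veronese subring of `k[x₁,…,xₙ]`: the `k`-subalgebra generated by the degree-`r` monomials. -/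
local notation3 "VR[" n ", " r "]" =>
  Algebra.adjoin k ((fun d : Fin n →₀ ℕ => MvPolynomial.monomial d (1 : k)) ''
    {d : Fin n →₀ ℕ | Finsupp.degree d = (r : ℕ)})

/-- The vertex ideal of the Veronese cone: spanned by the degree-`r` monomials. -/
local notation3 "VM[" n ", " r "]" =>
  Ideal.span {v : ↥VR[n, r] | ∃ d : Fin n →₀ ℕ, Finsupp.degree d = (r : ℕ) ∧
    (v : MvPolynomial (Fin n) k) = MvPolynomial.monomial d 1}

namespace VeroneseWeightZero

/-- **The Veronese subring is the degree-`0` part of `k[x₁,…,xₙ]` for the `ℤ/r`-grading with weights `(1,…,1)`**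
(`1 ≤ r`). [folklore] -/
theorem veronese_eq_gradeZero_subalgebra (n r : ℕ) (hr : 1 ≤ r) :
    letI := MvPolynomial.weightedGradedAlgebra k (fun _ : Fin n => (1 : ZMod r))
    VR[n, r] = SetLike.GradeZero.subalgebra
      (MvPolynomial.weightedHomogeneousSubmodule k (fun _ : Fin n => (1 : ZMod r))) := by
  letI := MvPolynomial.weightedGradedAlgebra k (fun _ : Fin n => (1 : ZMod r))
  haveI : NeZero r := ⟨by omega⟩
  apply SetLike.ext
  intro f
  rw [stub_veronese_mem_iff k n r hr (fun s d hd => stub_finsupp_degree_split r s d hd) f]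
  change _ ↔ f ∈ MvPolynomial.weightedHomogeneousSubmodule k (fun _ : Fin n => (1 : ZMod r)) (0 : ZMod r)
  rw [MvPolynomial.mem_weightedHomogeneousSubmodule]
  constructor
  · intro h d hd
    rw [veronese_summand_weight_eq_degree, ZMod.natCast_eq_zero_iff]
    exact h d (MvPolynomial.mem_support_iff.mpr hd)
  · intro h d hd
    have := h (MvPolynomial.mem_support_iff.mp hd)
    rwa [veronese_summand_weight_eq_degree, ZMod.natCast_eq_zero_iff] at this

/-- Elements of the vertex ideal have vanishing constant coefficient (`1 ≤ r`). [folklore] -/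
theorem constantCoeff_eq_zero_of_mem_vertexIdeal (n r : ℕ) (hr : 1 ≤ r) (v : ↥VR[n, r])
    (hv : v ∈ VM[n, r]) : MvPolynomial.constantCoeff (v : MP[n]) = 0 := by
  let cc : ↥VR[n, r] →+* k := (MvPolynomial.constantCoeff : MP[n] →+* k).comp (VR[n, r]).val.toRingHom
  have hle : VM[n, r] ≤ RingHom.ker cc := by
    rw [Ideal.span_le]
    rintro w ⟨d, hd, hw⟩
    rw [SetLike.mem_coe, RingHom.mem_ker]
    change MvPolynomial.constantCoeff (w : MP[n]) = 0
    rw [hw, MvPolynomial.constantCoeff_monomial]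
    have hd0 : d ≠ 0 := by
      intro h0
      rw [h0, map_zero] at hd
      omega
    exact if_neg hd0
  exact hle hv

/-- **THE ENDGAME STUB ON ITS ISOLATED WEIGHT-`(1,…,1)` CHARTS.** Let `X` be an integral `k`-scheme locally of
finite type (any field `k`) with finitely many singular points. Suppose every singular point is `φ y` for some
`n, r ≥ 2`, an ÉTALE morphism `φ : Spec S₀ → X` where `S₀ = 𝒮 0` is the degree-`0` part of `S = k[x₁,…,xₙ]` graded by
`ℤ/r` with weights `(1,…,1)` (`MvPolynomial.weightedGradedAlgebra`), and the vertex `y` of `Spec S₀` (the point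
containing every invariant with vanishing constant term). Then `X` has a resolution of singularities.
[cite: Kollar2007, §2.2] -/
theorem hasResolution_of_isolated_weightOne_etale_charts (X : Scheme.{0}) [IsIntegral X]
    (f : X ⟶ Spec (.of k)) [LocallyOfFiniteType f] (hfin : (Scheme.regularLocus X)ᶜ.Finite)
    (hchart : ∀ x : X, x ∉ Scheme.regularLocus X →
      ∃ (n r : ℕ) (_ : 2 ≤ n) (_ : 2 ≤ r),
        letI := MvPolynomial.weightedGradedAlgebra k (fun _ : Fin n => (1 : ZMod r))
        ∃ (φ : Spec (.of ↥(MvPolynomial.weightedHomogeneousSubmodule k (fun _ : Fin n => (1 : ZMod r)) 0)) ⟶ X)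
          (_ : Etale φ)
          (y : Spec (.of ↥(MvPolynomial.weightedHomogeneousSubmodule k (fun _ : Fin n => (1 : ZMod r)) 0))),
          φ y = x ∧ ∀ v : ↥(MvPolynomial.weightedHomogeneousSubmodule k (fun _ : Fin n => (1 : ZMod r)) 0),
            MvPolynomial.constantCoeff (v : MP[n]) = 0 → v ∈ y.asIdeal) :
    Scheme.HasResolution X := by
  refine VeroneseEtaleCharts.hasResolution_of_isolated_veronese_etale_charts k X f hfin fun x hx => ?_
  obtain ⟨n, r, hn, hr, φ, hφ, y, hyx, hvert⟩ := hchart x hx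
  letI := MvPolynomial.weightedGradedAlgebra k (fun _ : Fin n => (1 : ZMod r))
  have hr1 : 1 ≤ r := by omega
  -- the Veronese subring IS the degree-0 subalgebra
  let e : ↥VR[n, r] ≃ₐ[k] ↥(SetLike.GradeZero.subalgebra
      (MvPolynomial.weightedHomogeneousSubmodule k (fun _ : Fin n => (1 : ZMod r)))) :=
    Subalgebra.equivOfEq _ _ (veronese_eq_gradeZero_subalgebra k n r hr1)
  have he : ∀ v : ↥VR[n, r], ((e v : ↥(SetLike.GradeZero.subalgebra
      (MvPolynomial.weightedHomogeneousSubmodule k (fun _ : Fin n => (1 : ZMod r))))) : MP[n]) = (v : MP[n]) :=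
    fun v => rfl
  let ι : CommRingCat.of ↥VR[n, r] ≅ CommRingCat.of ↥(SetLike.GradeZero.subalgebra
      (MvPolynomial.weightedHomogeneousSubmodule k (fun _ : Fin n => (1 : ZMod r)))) :=
    e.toRingEquiv.toCommRingCatIso
  -- the chart from the Veronese cone
  haveI := hφ
  haveI : IsIso (Spec.map ι.inv) := inferInstance
  have hι : Etale (Spec.map ι.inv) := inferInstance
  have hφ' : Etale (Spec.map ι.inv ≫ φ) := MorphismProperty.comp_mem @Etale (Spec.map ι.inv) φ hι hφ
  have hy' : (Spec.map ι.inv ≫ φ) (Spec.map ι.hom y) = x := by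
    rw [Scheme.Hom.comp_apply, ← Scheme.Hom.comp_apply (Spec.map ι.hom) (Spec.map ι.inv), ← Spec.map_comp,
      ι.inv_hom_id, Spec.map_id]
    exact hyx
  refine ⟨n, r, hn, hr, Spec.map ι.inv ≫ φ, hφ', Spec.map ι.hom y, hy', ?_⟩
  -- the vertex ideal maps into `y`
  rw [Ideal.span_le]
  intro v hv
  have hv0 : MvPolynomial.constantCoeff (v : MP[n]) = 0 :=
    constantCoeff_eq_zero_of_mem_vertexIdeal k n r hr1 v (Ideal.subset_span hv)
  change ι.hom.hom v ∈ y.asIdeal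
  apply hvert
  have hval : ((ι.hom.hom v : ↥(SetLike.GradeZero.subalgebra
      (MvPolynomial.weightedHomogeneousSubmodule k (fun _ : Fin n => (1 : ZMod r))))) : MP[n]) = (v : MP[n]) :=
    he v
  rw [hval]
  exact hv0

end VeroneseWeightZero

end Cones

end Summit.ResolutionOfSingularities.ResolutionOfSingularities.Theorems.FRationalResolution

end
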